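import Summits.AtomisticToContinuum.Crystallization.Theorems.PerronTransitivityUniformBindingRigidityCohesionL

/-!
# Cohesion of uniformly bound Lennard-Jones configurations, XIV: sharp truncation and reduction

Helper file (`--supports stmt-AtomisticToContinuum-15099`) of the registered stub
`stub_localHalfSpaceCert` (= `(LOCAL)`) of the line `registered` of the crux
`Summit.AtomisticToContinuum.Crystallization.Theses.PerronTransitivity.UniformBindingRigidity`
(item stmt-AtomisticToContinuum-15099), continuing part XIII (the sharp sixth-power tail
`T(δ, R) = 16/(δ³R³) + 18/(δ²R⁴) + 36/(5δR⁵) + 1/R⁶`).  Notation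
`U_Y(p) = Σ'_{q ∈ Y, q ≠ p} V_LJ(dist p q)`:

* §25 `summable_and_neg_sharpTail_le_tsum_far` — `Σ'_{q ∈ B} V_LJ(dist p q) ≥ −T(δ, R)/6` for
  `B ⊆ {q ∈ Y : dist q p ≥ R}` (`V_LJ ≥ −r⁻⁶/6`); the truncation of a site sum to a finite part
  containing all points within `R` costs at most `T(δ, R)/6` (`sum_le_tsum_add_sharpTail_of_far`,
  `sum_near_sub_sharpTail_le_tsum` — registered as `stub_local_sharpTail`), and the single-site
  bound `−U_Y(p) ≤ #near/12 + T(δ, R)/6` (`neg_tsum_le_card_add_sharpTail`; closed form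
  `#near/12 + (1/6)(211/5)/(δ³R³)` for `R ≥ δ`, `neg_tsum_le_card_add_closedTail`);
* §26 the finite-certificate reduction of `(LOCAL)` with the SHARP allowance `T(9/20, R')/6`
  (`stub_local_of_finiteCert_sharp`, part XII's `local_of_finiteCert_of_tail`): at `R' = 6, 8, 10`
  the allowance is `< 0.148, 0.062, 0.031` against `≈ 8.7, 3.7, 1.9` with the constant `1024`, so
  a certificate with margin `0.062` on clusters of radius `14` now suffices.

All `[folklore]`.
-/

noncomputable section

namespace Summit.AtomisticToContinuum.Crystallization.Theorems.PerronTransitivityUniformBindingRigidity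

open scoped BigOperators Topology
open Filter Set Metric
open Literature.MathematicalPhysics.StatisticalMechanics
open Summit.AtomisticToContinuum.Crystallization.Theorems.ChargedEnergyGapNegative (E3)
open Summit.AtomisticToContinuum.Crystallization.Theorems.HullBulkOptimal
  (abs_lennardJones_le tsum_finite_eq_sum)

/-! ## §25 The sharp Lennard-Jones tail, truncation and the single-site bound -/

section Truncation

variable {Y : Set E3} {δ : ℝ}

/-- **Sharp far tail of a Lennard-Jones site sum.** For a `δ`-separated `Y`, any centre `p`,
`R > 0` and `B ⊆ {q ∈ Y : dist q p ≥ R}`: the family `V_LJ(dist p z)` is summable on `B` and its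
sum is `≥ −T(δ, R)/6` (`V_LJ ≥ −r⁻⁶/6`).  Compare part II's `summable_and_neg_le_tsum_far`
(`−(1/6)·1024/(δ³R³)`, `R ≥ δ`). [folklore] -/
theorem summable_and_neg_sharpTail_le_tsum_far (hδ : 0 < δ)
    (hsep : ∀ a ∈ Y, ∀ b ∈ Y, a ≠ b → δ ≤ dist a b) (p : E3) {R : ℝ} (hR : 0 < R) {B : Set E3}
    (hB : B ⊆ {q : E3 | q ∈ Y ∧ R ≤ dist q p}) :
    Summable (fun z : B => lennardJones (dist p (z : E3))) ∧
      -(1 / 6 * (16 / (δ ^ 3 * R ^ 3) + 18 / (δ ^ 2 * R ^ 4) + 36 / (5 * δ * R ^ 5) + 1 / R ^ 6)) ≤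
        ∑' z : B, lennardJones (dist p (z : E3)) := by
  obtain ⟨hg, hgle⟩ := summable_and_tsum_inv_pow_six_far_le_sharp hδ hsep p hR hB
  have hdist : ∀ z : B, R ≤ dist p (z : E3) := fun z => by
    rw [dist_comm]; exact (hB z.2).2
  have hV : Summable (fun z : B => lennardJones (dist p (z : E3))) := by
    refine Summable.of_norm_bounded (hg.mul_left (R⁻¹ ^ 6 / 12 + 1 / 6)) fun z => ?_
    rw [Real.norm_eq_abs, dist_comm p]
    have h := abs_lennardJones_le hR ((hdist z).trans_eq (dist_comm _ _))
    simpa using h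
  refine ⟨hV, ?_⟩
  have h1 : ∑' z : B, -(1 / 6 * (dist (z : E3) p)⁻¹ ^ 6) ≤
      ∑' z : B, lennardJones (dist p (z : E3)) := by
    refine Summable.tsum_le_tsum (fun z => ?_) (hg.mul_left (1 / 6)).neg hV
    rw [dist_comm p]
    have := ExcessDecayLiouvilleFineGrains.neg_inv_pow_six_le_lennardJones (dist (z : E3) p)
    simpa using this
  rw [tsum_neg, tsum_mul_left] at h1
  nlinarith

/-- **Truncation of a site sum to a finite part, sharp tail.** For a `δ`-separated `Y`, a centre
`a`, `R > 0` and a finite set `I ⊆ Y ∖ {a}` containing every point of `Y ∖ {a}` at distance `< R`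
from `a`: `Σ_{b ∈ I} V_LJ(dist a b) ≤ U_Y(a) + T(δ, R)/6` (part II's `sum_le_tsum_add_of_far` with
the sharp tail). [folklore] -/
theorem sum_le_tsum_add_sharpTail_of_far (hδ : 0 < δ)
    (hsep : ∀ a ∈ Y, ∀ b ∈ Y, a ≠ b → δ ≤ dist a b)
    (a : E3) {R : ℝ} (hR : 0 < R) (I : Finset E3) (hI : ∀ b ∈ I, b ∈ Y ∧ b ≠ a)
    (hfar : ∀ b ∈ Y, b ≠ a → b ∉ I → R ≤ dist b a) :
    ∑ b ∈ I, lennardJones (dist a b) ≤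
      ∑' b : {b : E3 // b ∈ Y ∧ b ≠ a}, lennardJones (dist a b.1) +
        1 / 6 * (16 / (δ ^ 3 * R ^ 3) + 18 / (δ ^ 2 * R ^ 4) + 36 / (5 * δ * R ^ 5) +
          1 / R ^ 6) := by
  classical
  set A : Set E3 := {b : E3 | b ∈ Y ∧ b ≠ a ∧ b ∈ I} with hA
  set B : Set E3 := {b : E3 | b ∈ Y ∧ b ≠ a ∧ b ∉ I} with hB
  have hT : ({b : E3 | b ∈ Y ∧ b ≠ a} : Set E3) = A ∪ B := by
    ext b
    simp only [hA, hB, mem_setOf_eq, mem_union]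
    tauto
  have hdisj : Disjoint A B := by
    rw [Set.disjoint_left]
    rintro b ⟨-, -, h1⟩ ⟨-, -, h2⟩
    exact h2 h1
  have hAfin : A.Finite := (I.finite_toSet).subset fun b hb => hb.2.2
  have hAF : hAfin.toFinset = I := by
    ext b
    rw [Set.Finite.mem_toFinset]
    simp only [hA, mem_setOf_eq]
    constructor
    · exact fun h => h.2.2
    · exact fun h => ⟨(hI b h).1, (hI b h).2, h⟩
  set f : E3 → ℝ := fun b => lennardJones (dist a b) with hf
  have hsA : Summable (f ∘ (↑) : A → ℝ) := by
    haveI := hAfin.to_subtype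
    exact Summable.of_finite
  have hBsub : B ⊆ {b : E3 | b ∈ Y ∧ R ≤ dist b a} := by
    rintro b ⟨hb, hba, hbI⟩
    exact ⟨hb, hfar b hb hba hbI⟩
  obtain ⟨hsB', htail⟩ := summable_and_neg_sharpTail_le_tsum_far hδ hsep a hR hBsub
  have hsB : Summable (f ∘ (↑) : B → ℝ) := hsB'
  have h0 : (∑' b : {b : E3 // b ∈ Y ∧ b ≠ a}, lennardJones (dist a b.1)) =
      ∑' b : ↥({b : E3 | b ∈ Y ∧ b ≠ a} : Set E3), f b := rfl
  have hsplit : ∑' b : {b : E3 // b ∈ Y ∧ b ≠ a}, lennardJones (dist a b.1) =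
      ∑' b : A, f b + ∑' b : B, f b := by
    rw [h0, tsum_congr_set_coe f hT]
    exact Summable.tsum_union_disjoint hdisj hsA hsB
  have hfinsum : ∑' b : A, f b = ∑ b ∈ I, lennardJones (dist a b) := by
    rw [← hAF]
    exact tsum_finite_eq_sum hAfin f
  have htail' : -(1 / 6 * (16 / (δ ^ 3 * R ^ 3) + 18 / (δ ^ 2 * R ^ 4) + 36 / (5 * δ * R ^ 5) +
      1 / R ^ 6)) ≤ ∑' b : B, f b := htail
  rw [hsplit, hfinsum]
  linarith

/-- **Lower truncation with the sharp tail.** For a `δ`-separated `Y`, any centre `p`, `R > 0`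
and the near set `F = {q ∈ Y ∖ {p} : dist q p ≤ R}`: `Σ_{q ∈ F} V_LJ(dist p q) − T(δ, R)/6 ≤ U_Y(p)`
(compare part IX's `sum_near_sub_tail_le_tsum`: `(1/6)·1024/(δ³R³)`, `R ≥ δ`). [folklore] -/
theorem sum_near_sub_sharpTail_le_tsum (hδ : 0 < δ)
    (hsep : ∀ a ∈ Y, ∀ b ∈ Y, a ≠ b → δ ≤ dist a b) (p : E3) {R : ℝ} (hR : 0 < R)
    (F : Finset E3) (hF : ∀ q, q ∈ F ↔ q ∈ Y ∧ q ≠ p ∧ dist q p ≤ R) :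
    ∑ q ∈ F, lennardJones (dist p q) -
        1 / 6 * (16 / (δ ^ 3 * R ^ 3) + 18 / (δ ^ 2 * R ^ 4) + 36 / (5 * δ * R ^ 5) + 1 / R ^ 6) ≤
      ∑' q : {q : E3 // q ∈ Y ∧ q ≠ p}, lennardJones (dist p q.1) := by
  have h := sum_le_tsum_add_sharpTail_of_far hδ hsep p hR F
    (fun b hb => ⟨((hF b).1 hb).1, ((hF b).1 hb).2.1⟩)
    (fun b hb hbp hbF => by
      by_contra hlt
      exact hbF ((hF b).2 ⟨hb, hbp, (not_le.1 hlt).le⟩))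
  linarith

/-- **Single-site binding bound with the sharp tail.** For a `δ`-separated `Y`, any centre `p`,
`R > 0` and the near set `F`: `−U_Y(p) ≤ #F/12 + T(δ, R)/6` (every near term is `≥ −1/12`).
[folklore] -/
theorem neg_tsum_le_card_add_sharpTail (hδ : 0 < δ)
    (hsep : ∀ a ∈ Y, ∀ b ∈ Y, a ≠ b → δ ≤ dist a b) (p : E3) {R : ℝ} (hR : 0 < R)
    (F : Finset E3) (hF : ∀ q, q ∈ F ↔ q ∈ Y ∧ q ≠ p ∧ dist q p ≤ R) :
    -(∑' q : {q : E3 // q ∈ Y ∧ q ≠ p}, lennardJones (dist p q.1)) ≤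
      1 / 12 * (F.card : ℝ) +
        1 / 6 * (16 / (δ ^ 3 * R ^ 3) + 18 / (δ ^ 2 * R ^ 4) + 36 / (5 * δ * R ^ 5) +
          1 / R ^ 6) := by
  have h1 := sum_near_sub_sharpTail_le_tsum hδ hsep p hR F hF
  have h2 := neg_card_div_le_sum_lennardJones F fun q => dist p q
  linarith

/-- **Closed form.** For a `δ`-separated `Y`, any centre `p`, `R ≥ δ` and the near set `F`:
`−U_Y(p) ≤ #F/12 + (1/6)(211/5)/(δ³R³)` — part IX's `neg_tsum_le_card_add_tail` with the constant
`1024` replaced by `211/5 = 42.2` (`sharpTail_le_closed`). [folklore] -/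
theorem neg_tsum_le_card_add_closedTail (hδ : 0 < δ)
    (hsep : ∀ a ∈ Y, ∀ b ∈ Y, a ≠ b → δ ≤ dist a b) (p : E3) {R : ℝ} (hR : δ ≤ R)
    (F : Finset E3) (hF : ∀ q, q ∈ F ↔ q ∈ Y ∧ q ≠ p ∧ dist q p ≤ R) :
    -(∑' q : {q : E3 // q ∈ Y ∧ q ≠ p}, lennardJones (dist p q.1)) ≤
      1 / 12 * (F.card : ℝ) + 1 / 6 * (211 / 5 / (δ ^ 3 * R ^ 3)) := by
  have h1 := neg_tsum_le_card_add_sharpTail hδ hsep p (hδ.trans_le hR) F hF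
  have h2 := sharpTail_le_closed hδ hR
  linarith

end Truncation

/-! ## §26 Registered sub-goals of `stub_localHalfSpaceCert`: sharp tail and sharp reduction -/

/-- **Sub-goal `stub_local_sharpTail` of the stub `stub_localHalfSpaceCert`** (registered on
stmt-AtomisticToContinuum-15099): for a `δ`-separated `Y ⊆ ℝ³`, any centre `p`, any radius `R > 0`
and the near set `N = {q ∈ Y ∖ {p} : dist q p ≤ R}`,
`Σ_{q ∈ N} V_LJ(dist p q) − T(δ, R)/6 ≤ U_Y(p)`, `T(δ, R) = 16/(δ³R³) + 18/(δ²R⁴) + 36/(5δR⁵) + 1/R⁶`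
(`sum_near_sub_sharpTail_le_tsum` in arrow form). [folklore] -/
theorem stub_local_sharpTail :
    ∀ (Y : Set (EuclideanSpace ℝ (Fin 3))) (δ : ℝ), 0 < δ →
      (∀ p ∈ Y, ∀ q ∈ Y, p ≠ q → δ ≤ dist p q) →
      ∀ (p : EuclideanSpace ℝ (Fin 3)) (R : ℝ), 0 < R →
      ∀ N : Finset (EuclideanSpace ℝ (Fin 3)),
        (∀ q, q ∈ N ↔ q ∈ Y ∧ q ≠ p ∧ dist q p ≤ R) →
        ∑ q ∈ N, lennardJones (dist p q) -
            1 / 6 * (16 / (δ ^ 3 * R ^ 3) + 18 / (δ ^ 2 * R ^ 4) + 36 / (5 * δ * R ^ 5) +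
              1 / R ^ 6) ≤
          ∑' q : {q : EuclideanSpace ℝ (Fin 3) // q ∈ Y ∧ q ≠ p}, lennardJones (dist p q.1) :=
  fun _ _ hδ hsep p _ hR N hN => sum_near_sub_sharpTail_le_tsum hδ hsep p hR N hN

/-- **Sub-goal `stub_local_of_finiteCert_sharp` of the stub `stub_localHalfSpaceCert`** (registered
on stmt-AtomisticToContinuum-15099): part XII's reduction `(∃ R' ≥ 1, FINCERT♯(R')) → (LOCAL)` with
the SHARP allowance `T(9/20, R')/6` in place of `(1/6)·1024/((9/20)³R'³)`
(`local_of_finiteCert_of_tail` with `stub_local_sharpTail` at `δ = 9/20`); e.g.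
`T(9/20, 8)/6 < 0.062`, so a certificate with margin `0.062` on clusters of radius `14` suffices.
[folklore] -/
theorem stub_local_of_finiteCert_sharp :
    (∃ R' : ℝ, 1 ≤ R' ∧
      ∀ (F : Finset (EuclideanSpace ℝ (Fin 3))) (u : EuclideanSpace ℝ (Fin 3)), ‖u‖ = 1 →
        (0 : EuclideanSpace ℝ (Fin 3)) ∈ F →
        (∀ a ∈ F, ∀ b ∈ F, a ≠ b → 9 / 20 ≤ dist a b) →
        (∀ a ∈ F, inner ℝ a u ≤ 0) →
        (∀ a ∈ F, dist a 0 ≤ 6 + R') →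
        ∃ p ∈ F, dist p 0 ≤ 6 ∧
          ∀ N : Finset (EuclideanSpace ℝ (Fin 3)),
            (∀ q, q ∈ N ↔ q ∈ F ∧ q ≠ p ∧ dist q p ≤ R') →
            -(711 / 500) + 1 / 6 * (16 / ((9 / 20) ^ 3 * R' ^ 3) + 18 / ((9 / 20) ^ 2 * R' ^ 4) +
                36 / (5 * (9 / 20) * R' ^ 5) + 1 / R' ^ 6) <
              ∑ q ∈ N, lennardJones (dist p q)) →
    ∀ (Y : Set (EuclideanSpace ℝ (Fin 3))) (u : EuclideanSpace ℝ (Fin 3)), ‖u‖ = 1 →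
      (0 : EuclideanSpace ℝ (Fin 3)) ∈ Y →
      (∀ p ∈ Y, ∀ q ∈ Y, p ≠ q → 9 / 20 ≤ dist p q) →
      (∀ q ∈ Y, inner ℝ q u ≤ 0) →
      (∀ p ∈ Y, dist p 0 ≤ 6 → ∑' q : {q : EuclideanSpace ℝ (Fin 3) // q ∈ Y ∧ q ≠ p},
          lennardJones (dist p q.1) ≤ -(711 / 500)) →
      False := by
  rintro ⟨R', hR', hcert⟩ Y u hu h0 hsep hhalf hU
  have hδ : (0 : ℝ) < 9 / 20 := by norm_num
  exact local_of_finiteCert_of_tail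
    (τ := 1 / 6 * (16 / ((9 / 20 : ℝ) ^ 3 * R' ^ 3) + 18 / ((9 / 20 : ℝ) ^ 2 * R' ^ 4) +
      36 / (5 * (9 / 20 : ℝ) * R' ^ 5) + 1 / R' ^ 6))
    (by linarith) (fun Y' hsep' p N hN => sum_near_sub_sharpTail_le_tsum hδ hsep' p (by linarith) N hN)
    hcert Y u hu h0 hsep hhalf hU

end Summit.AtomisticToContinuum.Crystallization.Theorems.PerronTransitivityUniformBindingRigidity

end
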